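import Summits.AnomalousDissipation.AnomalousDissipation.Theorems.SolenoidalFractalHomogenisationRealisedQuasiStaticCellLawComovingWeightsCalc
import HarnessLib

/-!
# K2R `RealisedQuasiStaticCellLaw`, line `floquet-bloch`, stub `stub_lowSectorDecay` (S1D): the co-moving pair weights
# (W-near regime) — derivatives, lower bound, start and end (metric reset)

Summits-side helper file (everything proved; no definitions, no named facts; `--supports stmt-AnomalousDissipation-20446`).
The EXPLICIT weights of the joint slow form consumed by `isoSector_decay_ae`: in slot `j` of period `q`, with
`r = t − (qP + start j)`, `I_k(r) = Λ_j(d₀,j r + σ_k,j g₁,j² ∫₀ʳ trapezoid²)` (`k = o, i`), the frame-`0` transport matrices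
`C_j` (`C₀ = 1`, `C_{j+1} = C_j R_jᵀ diag(e^{X_o,j}, e^{X_i,j}) R_j`, `R_j = [[rc_j, rs_j],[−rs_j, rc_j]]` the frame rotation
of slot `j`, `X_k,j = I_k(τ_j)` the full-slot nominal exponents) supplied as four real sequences with their recursion, and
`v₁ = C_jR_jᵀe₁`, `v₂ = C_jR_jᵀe₂`:
`a = e^{−2λ̄(t−qP) + 2I_o}|v₁|²`, `b = e^{−2λ̄(t−qP) + 2I_i}|v₂|²`, `c = e^{−2λ̄(t−qP) + I_o + I_i} v₁·v₂`.
Proved here: the co-moving derivative identities (`comoving_hwa/hwb/hwc`), the lower bound `G ≥ e^{−2λ̄P}`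
(`comoving_hG`, from expansiveness of the `C_j`, `comoving_expansive`), the START identity (`comoving_start`) and the END
inequality from an expansion bound on `C_{k₀}` (`comoving_end`) — the latter is where the near-commuting product estimate
and the isotropy of the word enter at the arithmetic level.
-/

set_option linter.dupNamespace false

noncomputable section

namespace Summit.AnomalousDissipation.AnomalousDissipation.Theorems.SolenoidalFractalHomogenisation.RealisedQuasiStaticCellLaw

open Set MeasureTheory Filter Topology Function Complex
open scoped ComplexConjugate
open Literature.Analysis.FluidPDE Literature.Analysis.FluidPDE.LatticeShear
open Summit.AnomalousDissipation.AnomalousDissipation.Theorems.SolenoidalFractalHomogenisation.PermissibleCarrier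

variable {k₀ : ℕ}

/-- The exponent of the co-moving weights and its derivative. -/
theorem comoving_exponent_hasDerivAt (W : LatticeWord k₀) (Λ d0 σ g₁ : Fin k₀ → ℝ) (lam κ : ℝ) (q : ℕ) (j : Fin k₀)
    (t : ℝ) :
    HasDerivAt (fun t => -(2 * lam * (t - (q : ℝ) * W.period)) +
        κ * (Λ j * (d0 j * (t - ((q : ℝ) * W.period + W.start j)) + σ j * g₁ j ^ 2 * (∫ s in (0:ℝ)..(t - ((q : ℝ) * W.period + W.start j)), LatticeWord.trapezoid 0 (W.phase j).τ W.ramp s ^ 2))))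
      (-(2 * lam) + κ * (Λ j * (d0 j + σ j * g₁ j ^ 2 * LatticeWord.trapezoid 0 (W.phase j).τ W.ramp (t - ((q : ℝ) * W.period + W.start j)) ^ 2))) t := by
  have h1 : HasDerivAt (fun t => t - ((q : ℝ) * W.period + W.start j)) 1 t := (hasDerivAt_id t).sub_const _
  have hF := (hasDerivAt_integral_trapezoid_sq (W.phase j).τ W.ramp (t - ((q : ℝ) * W.period + W.start j))).comp t h1
  have h2 : HasDerivAt (fun t => 2 * lam * (t - (q : ℝ) * W.period)) (2 * lam * 1) t :=
    ((hasDerivAt_id t).sub_const ((q : ℝ) * W.period)).const_mul (2 * lam)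
  have h3 := (((h1.const_mul (d0 j)).fun_add (hF.const_mul (σ j * g₁ j ^ 2))).const_mul (Λ j)).const_mul κ
  have h4 := h2.fun_neg.fun_add h3
  refine h4.congr_deriv ?_
  simp only [mul_one]

/-- **Co-moving derivative of the weight `a`.** -/
theorem comoving_hwa (W : LatticeWord k₀) (Λ d0 σo g₁ rc rs : Fin k₀ → ℝ) (lam : ℝ) (c₁₁ c₁₂ c₂₁ c₂₂ : ℕ → ℝ) :
    ∀ q : ℕ, ∀ j : Fin k₀, ∀ t ∈ Icc ((q : ℝ) * W.period + W.start j) ((q : ℝ) * W.period + W.start j + (W.phase j).τ),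
      HasDerivWithinAt (fun t => Real.exp (-(2 * lam * (t - (q : ℝ) * W.period)) + 2 * (Λ j * (d0 j * (t - ((q : ℝ) * W.period + W.start j)) + σo j * g₁ j ^ 2 * (∫ s in (0:ℝ)..(t - ((q : ℝ) * W.period + W.start j)), LatticeWord.trapezoid 0 (W.phase j).τ W.ramp s ^ 2)))) * ((c₁₁ j * rc j + c₁₂ j * rs j) ^ 2 + (c₂₁ j * rc j + c₂₂ j * rs j) ^ 2))
        ((2 * (Λ j * (d0 j + (g₁ j * LatticeWord.trapezoid 0 (W.phase j).τ W.ramp (t - ((q : ℝ) * W.period + W.start j))) ^ 2 * σo j) - lam)) *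
          (Real.exp (-(2 * lam * (t - (q : ℝ) * W.period)) + 2 * (Λ j * (d0 j * (t - ((q : ℝ) * W.period + W.start j)) + σo j * g₁ j ^ 2 * (∫ s in (0:ℝ)..(t - ((q : ℝ) * W.period + W.start j)), LatticeWord.trapezoid 0 (W.phase j).τ W.ramp s ^ 2)))) * ((c₁₁ j * rc j + c₁₂ j * rs j) ^ 2 + (c₂₁ j * rc j + c₂₂ j * rs j) ^ 2)))
        (Icc ((q : ℝ) * W.period + W.start j) ((q : ℝ) * W.period + W.start j + (W.phase j).τ)) t := by
  intro q j t _
  have h := ((comoving_exponent_hasDerivAt W Λ d0 σo g₁ lam 2 q j t).exp.mul_const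
    ((c₁₁ j * rc j + c₁₂ j * rs j) ^ 2 + (c₂₁ j * rc j + c₂₂ j * rs j) ^ 2)).hasDerivWithinAt (s := Icc ((q : ℝ) * W.period + W.start j) ((q : ℝ) * W.period + W.start j + (W.phase j).τ))
  refine h.congr_deriv ?_
  ring

/-- **Co-moving derivative of the weight `b`.** -/
theorem comoving_hwb (W : LatticeWord k₀) (Λ d0 σi g₁ rc rs : Fin k₀ → ℝ) (lam : ℝ) (c₁₁ c₁₂ c₂₁ c₂₂ : ℕ → ℝ) :
    ∀ q : ℕ, ∀ j : Fin k₀, ∀ t ∈ Icc ((q : ℝ) * W.period + W.start j) ((q : ℝ) * W.period + W.start j + (W.phase j).τ),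
      HasDerivWithinAt (fun t => Real.exp (-(2 * lam * (t - (q : ℝ) * W.period)) + 2 * (Λ j * (d0 j * (t - ((q : ℝ) * W.period + W.start j)) + σi j * g₁ j ^ 2 * (∫ s in (0:ℝ)..(t - ((q : ℝ) * W.period + W.start j)), LatticeWord.trapezoid 0 (W.phase j).τ W.ramp s ^ 2)))) * ((-(c₁₁ j * rs j) + c₁₂ j * rc j) ^ 2 + (-(c₂₁ j * rs j) + c₂₂ j * rc j) ^ 2))
        ((2 * (Λ j * (d0 j + (g₁ j * LatticeWord.trapezoid 0 (W.phase j).τ W.ramp (t - ((q : ℝ) * W.period + W.start j))) ^ 2 * σi j) - lam)) *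
          (Real.exp (-(2 * lam * (t - (q : ℝ) * W.period)) + 2 * (Λ j * (d0 j * (t - ((q : ℝ) * W.period + W.start j)) + σi j * g₁ j ^ 2 * (∫ s in (0:ℝ)..(t - ((q : ℝ) * W.period + W.start j)), LatticeWord.trapezoid 0 (W.phase j).τ W.ramp s ^ 2)))) * ((-(c₁₁ j * rs j) + c₁₂ j * rc j) ^ 2 + (-(c₂₁ j * rs j) + c₂₂ j * rc j) ^ 2)))
        (Icc ((q : ℝ) * W.period + W.start j) ((q : ℝ) * W.period + W.start j + (W.phase j).τ)) t := by
  intro q j t _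
  have h := ((comoving_exponent_hasDerivAt W Λ d0 σi g₁ lam 2 q j t).exp.mul_const
    ((-(c₁₁ j * rs j) + c₁₂ j * rc j) ^ 2 + (-(c₂₁ j * rs j) + c₂₂ j * rc j) ^ 2)).hasDerivWithinAt (s := Icc ((q : ℝ) * W.period + W.start j) ((q : ℝ) * W.period + W.start j + (W.phase j).τ))
  refine h.congr_deriv ?_
  ring

/-- **Co-moving derivative of the weight `c`.** -/
theorem comoving_hwc (W : LatticeWord k₀) (Λ d0 σo σi g₁ rc rs : Fin k₀ → ℝ) (lam : ℝ) (c₁₁ c₁₂ c₂₁ c₂₂ : ℕ → ℝ) :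
    ∀ q : ℕ, ∀ j : Fin k₀, ∀ t ∈ Icc ((q : ℝ) * W.period + W.start j) ((q : ℝ) * W.period + W.start j + (W.phase j).τ),
      HasDerivWithinAt (fun t => (((Real.exp (-(2 * lam * (t - (q : ℝ) * W.period)) + (Λ j * (d0 j * (t - ((q : ℝ) * W.period + W.start j)) + σo j * g₁ j ^ 2 * (∫ s in (0:ℝ)..(t - ((q : ℝ) * W.period + W.start j)), LatticeWord.trapezoid 0 (W.phase j).τ W.ramp s ^ 2))) + (Λ j * (d0 j * (t - ((q : ℝ) * W.period + W.start j)) + σi j * g₁ j ^ 2 * (∫ s in (0:ℝ)..(t - ((q : ℝ) * W.period + W.start j)), LatticeWord.trapezoid 0 (W.phase j).τ W.ramp s ^ 2)))) * ((c₁₁ j * rc j + c₁₂ j * rs j) * (-(c₁₁ j * rs j) + c₁₂ j * rc j) + (c₂₁ j * rc j + c₂₂ j * rs j) * (-(c₂₁ j * rs j) + c₂₂ j * rc j))) : ℝ) : ℂ))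
        (((Λ j * (d0 j + (g₁ j * LatticeWord.trapezoid 0 (W.phase j).τ W.ramp (t - ((q : ℝ) * W.period + W.start j))) ^ 2 * σo j) +
            Λ j * (d0 j + (g₁ j * LatticeWord.trapezoid 0 (W.phase j).τ W.ramp (t - ((q : ℝ) * W.period + W.start j))) ^ 2 * σi j) - 2 * lam : ℝ) : ℂ) *
          (((Real.exp (-(2 * lam * (t - (q : ℝ) * W.period)) + (Λ j * (d0 j * (t - ((q : ℝ) * W.period + W.start j)) + σo j * g₁ j ^ 2 * (∫ s in (0:ℝ)..(t - ((q : ℝ) * W.period + W.start j)), LatticeWord.trapezoid 0 (W.phase j).τ W.ramp s ^ 2))) + (Λ j * (d0 j * (t - ((q : ℝ) * W.period + W.start j)) + σi j * g₁ j ^ 2 * (∫ s in (0:ℝ)..(t - ((q : ℝ) * W.period + W.start j)), LatticeWord.trapezoid 0 (W.phase j).τ W.ramp s ^ 2)))) * ((c₁₁ j * rc j + c₁₂ j * rs j) * (-(c₁₁ j * rs j) + c₁₂ j * rc j) + (c₂₁ j * rc j + c₂₂ j * rs j) * (-(c₂₁ j * rs j) + c₂₂ j * rc j))) : ℝ) :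 ℂ))
        (Icc ((q : ℝ) * W.period + W.start j) ((q : ℝ) * W.period + W.start j + (W.phase j).τ)) t := by
  intro q j t _
  have e : ∀ t, -(2 * lam * (t - (q : ℝ) * W.period)) + (Λ j * (d0 j * (t - ((q : ℝ) * W.period + W.start j)) + σo j * g₁ j ^ 2 * (∫ s in (0:ℝ)..(t - ((q : ℝ) * W.period + W.start j)), LatticeWord.trapezoid 0 (W.phase j).τ W.ramp s ^ 2))) + (Λ j * (d0 j * (t - ((q : ℝ) * W.period + W.start j)) + σi j * g₁ j ^ 2 * (∫ s in (0:ℝ)..(t - ((q : ℝ) * W.period + W.start j)), LatticeWord.trapezoid 0 (W.phase j).τ W.ramp s ^ 2))) =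
      (-(2 * lam * (t - (q : ℝ) * W.period)) + 1 * (Λ j * (d0 j * (t - ((q : ℝ) * W.period + W.start j)) + σo j * g₁ j ^ 2 * (∫ s in (0:ℝ)..(t - ((q : ℝ) * W.period + W.start j)), LatticeWord.trapezoid 0 (W.phase j).τ W.ramp s ^ 2)))) +
        (-(2 * 0 * (t - (q : ℝ) * W.period)) + 1 * (Λ j * (d0 j * (t - ((q : ℝ) * W.period + W.start j)) + σi j * g₁ j ^ 2 * (∫ s in (0:ℝ)..(t - ((q : ℝ) * W.period + W.start j)), LatticeWord.trapezoid 0 (W.phase j).τ W.ramp s ^ 2)))) := by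
    intro t; ring
  have ho := comoving_exponent_hasDerivAt W Λ d0 σo g₁ lam 1 q j t
  have hi := comoving_exponent_hasDerivAt W Λ d0 σi g₁ 0 1 q j t
  have hsum := ((ho.fun_add hi).exp.mul_const ((c₁₁ j * rc j + c₁₂ j * rs j) * (-(c₁₁ j * rs j) + c₁₂ j * rc j) + (c₂₁ j * rc j + c₂₂ j * rs j) * (-(c₂₁ j * rs j) + c₂₂ j * rc j))).hasDerivWithinAt
    (s := Icc ((q : ℝ) * W.period + W.start j) ((q : ℝ) * W.period + W.start j + (W.phase j).τ))
  have hC := hsum.ofReal_comp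
  simp only [← e] at hC
  refine hC.congr_deriv ?_
  push_cast
  ring

/-- **Lower bound of the joint slow form**: `G ≥ e^{−2λ̄P}` on every slot of every period. -/
theorem comoving_hG (W : LatticeWord k₀) (Λ d0 σo σi g₁ rc rs : Fin k₀ → ℝ) (lam : ℝ) (c₁₁ c₁₂ c₂₁ c₂₂ : ℕ → ℝ)
    (hΛ : ∀ j, 0 ≤ Λ j) (hd0 : ∀ j, 0 ≤ d0 j) (hσo : ∀ j, 0 ≤ σo j) (hσi : ∀ j, 0 ≤ σi j) (hlam : 0 ≤ lam)
    (hrot : ∀ j, rc j ^ 2 + rs j ^ 2 = 1)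
    (hCexp : ∀ j : Fin k₀, ∀ z₁ z₂ : ℝ,
      z₁ ^ 2 + z₂ ^ 2 ≤ (c₁₁ j * z₁ + c₁₂ j * z₂) ^ 2 + (c₂₁ j * z₁ + c₂₂ j * z₂) ^ 2) :
    ∀ q : ℕ, ∀ j : Fin k₀, ∀ t ∈ Icc ((q : ℝ) * W.period + W.start j) ((q : ℝ) * W.period + W.start j + (W.phase j).τ), ∀ y₁ y₂ : ℂ,
      Real.exp (-(2 * lam * W.period)) * (‖y₁‖ ^ 2 + ‖y₂‖ ^ 2) ≤
        Real.exp (-(2 * lam * (t - (q : ℝ) * W.period)) + 2 * (Λ j * (d0 j * (t - ((q : ℝ) * W.period + W.start j)) + σo j * g₁ j ^ 2 * (∫ s in (0:ℝ)..(t - ((q : ℝ) * W.period + W.start j)), LatticeWord.trapezoid 0 (W.phase j).τ W.ramp s ^ 2)))) * ((c₁₁ j * rc j + c₁₂ j * rs j) ^ 2 + (c₂₁ j * rc j + c₂₂ j * rs j) ^ 2) * ‖y₁‖ ^ 2 +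
          Real.exp (-(2 * lam * (t - (q : ℝ) * W.period)) + 2 * (Λ j * (d0 j * (t - ((q : ℝ) * W.period + W.start j)) + σi j * g₁ j ^ 2 * (∫ s in (0:ℝ)..(t - ((q : ℝ) * W.period + W.start j)), LatticeWord.trapezoid 0 (W.phase j).τ W.ramp s ^ 2)))) * ((-(c₁₁ j * rs j) + c₁₂ j * rc j) ^ 2 + (-(c₂₁ j * rs j) + c₂₂ j * rc j) ^ 2) * ‖y₂‖ ^ 2 +
          2 * ((((Real.exp (-(2 * lam * (t - (q : ℝ) * W.period)) + (Λ j * (d0 j * (t - ((q : ℝ) * W.period + W.start j)) + σo j * g₁ j ^ 2 * (∫ s in (0:ℝ)..(t - ((q : ℝ) * W.period + W.start j)), LatticeWord.trapezoid 0 (W.phase j).τ W.ramp s ^ 2))) + (Λ j * (d0 j * (t - ((q : ℝ) * W.period + W.start j)) + σi j * g₁ j ^ 2 * (∫ s in (0:ℝ)..(t - ((q : ℝ) * W.period + W.start j)), LatticeWord.trapezoid 0 (W.phase j).τ W.ramp s ^ 2)))) * ((c₁₁ j * rc j + c₁₂ j * rs j) * (-(c₁₁ j * rs j) + c₁₂ j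 * rc j) + (c₂₁ j * rc j + c₂₂ j * rs j) * (-(c₂₁ j * rs j) + c₂₂ j * rc j))) : ℝ) : ℂ) * conj (y₁) * (y₂)).re := by
  intro q j t ht y₁ y₂
  have hτ := (W.phase j).τ_pos
  have hr : t - ((q : ℝ) * W.period + W.start j) ∈ Icc 0 (W.phase j).τ := ⟨by linarith [ht.1], by linarith [ht.2]⟩
  have hF := integral_trapezoid_sq_bounds hτ W.ramp_pos W.ramp_le hr
  obtain ⟨Fo, hFo⟩ : ∃ Fo : ℝ, Fo = (∫ s in (0:ℝ)..(t - ((q : ℝ) * W.period + W.start j)), LatticeWord.trapezoid 0 (W.phase j).τ W.ramp s ^ 2) := ⟨_, rfl⟩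
  obtain ⟨Io, hIo⟩ : ∃ Io : ℝ, Io = (Λ j * (d0 j * (t - ((q : ℝ) * W.period + W.start j)) + σo j * g₁ j ^ 2 * (∫ s in (0:ℝ)..(t - ((q : ℝ) * W.period + W.start j)), LatticeWord.trapezoid 0 (W.phase j).τ W.ramp s ^ 2))) := ⟨_, rfl⟩
  obtain ⟨Ii, hIi⟩ : ∃ Ii : ℝ, Ii = (Λ j * (d0 j * (t - ((q : ℝ) * W.period + W.start j)) + σi j * g₁ j ^ 2 * (∫ s in (0:ℝ)..(t - ((q : ℝ) * W.period + W.start j)), LatticeWord.trapezoid 0 (W.phase j).τ W.ramp s ^ 2))) := ⟨_, rfl⟩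
  rw [← hIo, ← hIi]
  rw [← hFo] at hIo hIi hF
  have hIo0 : 0 ≤ Io := by
    rw [hIo]
    exact mul_nonneg (hΛ j) (add_nonneg (mul_nonneg (hd0 j) hr.1)
      (mul_nonneg (mul_nonneg (hσo j) (sq_nonneg _)) hF.1))
  have hIi0 : 0 ≤ Ii := by
    rw [hIi]
    exact mul_nonneg (hΛ j) (add_nonneg (mul_nonneg (hd0 j) hr.1)
      (mul_nonneg (mul_nonneg (hσi j) (sq_nonneg _)) hF.1))
  obtain ⟨sP, hsP⟩ : ∃ sP : ℝ, sP = t - (q : ℝ) * W.period := ⟨_, rfl⟩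
  have hsP0 : 0 ≤ sP := by rw [hsP]; linarith [ht.1, start_nonneg W j]
  have hsPP : sP ≤ W.period := by rw [hsP]; linarith [ht.2, start_add_tau_le_period W j]
  rw [← hsP]
  obtain ⟨κ, hκ⟩ : ∃ κ : ℝ, κ = Real.exp (-(lam * sP)) := ⟨_, rfl⟩
  obtain ⟨Eo, hEo⟩ : ∃ Eo : ℝ, Eo = Real.exp Io := ⟨_, rfl⟩
  obtain ⟨Ei, hEi⟩ : ∃ Ei : ℝ, Ei = Real.exp Ii := ⟨_, rfl⟩
  have e1 : Real.exp (-(2 * lam * sP) + 2 * Io) = (κ * Eo) ^ 2 := by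
    rw [hκ, hEo, mul_pow, ← Real.exp_nat_mul, ← Real.exp_nat_mul, ← Real.exp_add]; congr 1; push_cast; ring
  have e2 : Real.exp (-(2 * lam * sP) + 2 * Ii) = (κ * Ei) ^ 2 := by
    rw [hκ, hEi, mul_pow, ← Real.exp_nat_mul, ← Real.exp_nat_mul, ← Real.exp_add]; congr 1; push_cast; ring
  have e3 : Real.exp (-(2 * lam * sP) + Io + Ii) = (κ * Eo) * (κ * Ei) := by
    rw [hκ, hEo, hEi, show -(2 * lam * sP) + Io + Ii = (-(lam * sP) + Io) + (-(lam * sP) + Ii) by ring, Real.exp_add,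
      Real.exp_add, Real.exp_add]
  rw [e1, e2, e3]
  -- Gram form
  have hgram := pairForm_gram (κ * Eo * (c₁₁ j * rc j + c₁₂ j * rs j)) (κ * Eo * (c₂₁ j * rc j + c₂₂ j * rs j)) (κ * Ei * (-(c₁₁ j * rs j) + c₁₂ j * rc j)) (κ * Ei * (-(c₂₁ j * rs j) + c₂₂ j * rc j)) y₁ y₂
  have eA : (κ * Eo) ^ 2 * ((c₁₁ j * rc j + c₁₂ j * rs j) ^ 2 + (c₂₁ j * rc j + c₂₂ j * rs j) ^ 2) = (κ * Eo * (c₁₁ j * rc j + c₁₂ j * rs j)) ^ 2 + (κ * Eo * (c₂₁ j * rc j + c₂₂ j * rs j)) ^ 2 := by ring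
  have eB : (κ * Ei) ^ 2 * ((-(c₁₁ j * rs j) + c₁₂ j * rc j) ^ 2 + (-(c₂₁ j * rs j) + c₂₂ j * rc j) ^ 2) = (κ * Ei * (-(c₁₁ j * rs j) + c₁₂ j * rc j)) ^ 2 + (κ * Ei * (-(c₂₁ j * rs j) + c₂₂ j * rc j)) ^ 2 := by ring
  have eC : (κ * Eo) * (κ * Ei) * ((c₁₁ j * rc j + c₁₂ j * rs j) * (-(c₁₁ j * rs j) + c₁₂ j * rc j) + (c₂₁ j * rc j + c₂₂ j * rs j) * (-(c₂₁ j * rs j) + c₂₂ j * rc j)) =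
      (κ * Eo * (c₁₁ j * rc j + c₁₂ j * rs j)) * (κ * Ei * (-(c₁₁ j * rs j) + c₁₂ j * rc j)) + (κ * Eo * (c₂₁ j * rc j + c₂₂ j * rs j)) * (κ * Ei * (-(c₂₁ j * rs j) + c₂₂ j * rc j)) := by ring
  rw [eA, eB, eC, hgram]
  -- lower bound of the real quadratic form
  have hκ2 : Real.exp (-(2 * lam * W.period)) ≤ κ ^ 2 := by
    rw [hκ, ← Real.exp_nat_mul]
    exact Real.exp_le_exp.2 (by push_cast; linarith [mul_le_mul_of_nonneg_left hsPP hlam])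
  have hEo1 : 1 ≤ Eo := by rw [hEo]; exact Real.one_le_exp hIo0
  have hEi1 : 1 ≤ Ei := by rw [hEi]; exact Real.one_le_exp hIi0
  have hQ : ∀ ξ₁ ξ₂ : ℝ, Real.exp (-(2 * lam * W.period)) * (ξ₁ ^ 2 + ξ₂ ^ 2) ≤
      (ξ₁ * (κ * Eo * (c₁₁ j * rc j + c₁₂ j * rs j)) + ξ₂ * (κ * Ei * (-(c₁₁ j * rs j) + c₁₂ j * rc j))) ^ 2 +
        (ξ₁ * (κ * Eo * (c₂₁ j * rc j + c₂₂ j * rs j)) + ξ₂ * (κ * Ei * (-(c₂₁ j * rs j) + c₂₂ j * rc j))) ^ 2 := by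
    intro ξ₁ ξ₂
    have k1 : ξ₁ * (κ * Eo * (c₁₁ j * rc j + c₁₂ j * rs j)) + ξ₂ * (κ * Ei * (-(c₁₁ j * rs j) + c₁₂ j * rc j)) =
        κ * (c₁₁ j * (rc j * (Eo * ξ₁) - rs j * (Ei * ξ₂)) + c₁₂ j * (rs j * (Eo * ξ₁) + rc j * (Ei * ξ₂))) := by ring
    have k2 : ξ₁ * (κ * Eo * (c₂₁ j * rc j + c₂₂ j * rs j)) + ξ₂ * (κ * Ei * (-(c₂₁ j * rs j) + c₂₂ j * rc j)) =
        κ * (c₂₁ j * (rc j * (Eo * ξ₁) - rs j * (Ei * ξ₂)) + c₂₂ j * (rs j * (Eo * ξ₁) + rc j * (Ei * ξ₂))) := by ring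
    rw [k1, k2, mul_pow, mul_pow, ← mul_add]
    have hC := hCexp j (rc j * (Eo * ξ₁) - rs j * (Ei * ξ₂)) (rs j * (Eo * ξ₁) + rc j * (Ei * ξ₂))
    have hn : (rc j * (Eo * ξ₁) - rs j * (Ei * ξ₂)) ^ 2 + (rs j * (Eo * ξ₁) + rc j * (Ei * ξ₂)) ^ 2 =
        (Eo * ξ₁) ^ 2 + (Ei * ξ₂) ^ 2 := by
      linear_combination ((Eo * ξ₁) ^ 2 + (Ei * ξ₂) ^ 2) * hrot j
    have hm₁ := mul_le_mul_of_nonneg_right (one_le_pow₀ hEo1 : (1:ℝ) ≤ Eo ^ 2) (sq_nonneg ξ₁)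
    have hm₂ := mul_le_mul_of_nonneg_right (one_le_pow₀ hEi1 : (1:ℝ) ≤ Ei ^ 2) (sq_nonneg ξ₂)
    rw [one_mul, ← mul_pow] at hm₁ hm₂
    have hsum : ξ₁ ^ 2 + ξ₂ ^ 2 ≤ (c₁₁ j * (rc j * (Eo * ξ₁) - rs j * (Ei * ξ₂)) + c₁₂ j * (rs j * (Eo * ξ₁) + rc j * (Ei * ξ₂))) ^ 2 +
        (c₂₁ j * (rc j * (Eo * ξ₁) - rs j * (Ei * ξ₂)) + c₂₂ j * (rs j * (Eo * ξ₁) + rc j * (Ei * ξ₂))) ^ 2 := by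
      linarith [hC, hn, hm₁, hm₂]
    have hξ : 0 ≤ ξ₁ ^ 2 + ξ₂ ^ 2 := by positivity
    calc Real.exp (-(2 * lam * W.period)) * (ξ₁ ^ 2 + ξ₂ ^ 2) ≤ κ ^ 2 * (ξ₁ ^ 2 + ξ₂ ^ 2) :=
          mul_le_mul_of_nonneg_right hκ2 hξ
      _ ≤ _ := mul_le_mul_of_nonneg_left hsum (sq_nonneg κ)
  have h1 := hQ y₁.re y₂.re
  have h2 := hQ y₁.im y₂.im
  have hy₁ : ‖y₁‖ ^ 2 = y₁.re ^ 2 + y₁.im ^ 2 := by rw [Complex.sq_norm, Complex.normSq_apply]; ring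
  have hy₂ : ‖y₂‖ ^ 2 = y₂.re ^ 2 + y₂.im ^ 2 := by rw [Complex.sq_norm, Complex.normSq_apply]; ring
  rw [hy₁, hy₂]
  linarith [h1, h2]

end Summit.AnomalousDissipation.AnomalousDissipation.Theorems.SolenoidalFractalHomogenisation.RealisedQuasiStaticCellLaw

end
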